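import Summits.HubbardSuperconductivity.HubbardSuperconductivity.Theorems.KLProgrammeKLRegimeScaleZeroCovarianceMomentumJets
import Summits.HubbardSuperconductivity.HubbardSuperconductivity.Theorems.KLProgrammeSalmhoferCutoffDerivTableRecord
import Summits.HubbardSuperconductivity.HubbardSuperconductivity.Theorems.KLProgrammeSalmhoferCutoffDerivTableRecordV2

/-!
# Route `KLProgramme`, crux K3 — engine-flow child (stmt-HubbardSuperconductivity-20437), stub (C) at `n = 0`, #22a «(C)-SCALE0-PT2» §2a (L):
# the last hypothesis of the bare-frame momentum jets — the cutoff table `B` — DISCHARGED with the proved numerals `klChi2CauchyTab n`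

Cell gate-hubbard-kl, seat p2 g18 (item (2e) «sharp χ₂ table»).  p1 g19's `…ScaleZeroCovarianceMomentumJets` proves the momentum jets of the scale-0 spatial symbol,
the torus-comparison clause and the off-site L-uniform decay at the bare frame modulo ONE table hypothesis `hB : ∀ i ≤ n, ∀ t, ‖iteratedDeriv i χ₂ t‖ ≤ B`
(`1 ≤ B`).  The proved table of `…SalmhoferCutoffDerivTableRecord` (`klChi2CauchyTab`: sharp rows `n ≤ 2`, Cauchy rows `3 ≤ n ≤ 16`, Gevrey rows beyond;
monotone; `≥ 1`) supplies `B := klChi2CauchyTab n` for every `n`, so the three statements hold with NO table hypothesis: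

* `salmhoferCutoff_flat_cauchy_table_deriv` — `∀ i ≤ n, ∀ t, ‖iteratedDeriv i χ₂ t‖ ≤ klChi2CauchyTab n` (the `hB` shape);
* **`norm_iteratedFDeriv_uvSpatialSymbol_bare_le_tab`** — `‖Dⁿ g_ω(y)‖ ≤ n!·(c·klChi2CauchyTab n·(n+1)!·(2/m(ω))·max(1,2/m(ω))ⁿ)·(8π)ⁿ`;
* **`norm_torusFourierInv_uvSpatialSample_sub_kernel_le_bare_tab`**, **`norm_torusFourierInv_uvSpatialSample_le_inv_pow_offSite_bare_tab`** — the §2a (L)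
  clauses at the bare frame with the table numerals (e.g. `n = 4`: `klChi2CauchyTab 4 = 509100`; `n = 8`: `1.109·10¹³`).

Version 2 (appended): the same three with the sharpened table `klChi2CauchyTab2` (`…_tab2`).
Proofs only; no definitions; nothing here asserts (C), any stub of 20437, K3 or superconductivity.  References: BGM 2006 (2.36aa), §3 (3.2)
[cite: BenfattoGiulianiMastropietro2006]; Salmhofer 1999 §4.2.5 (4.71).
-/

noncomputable section

namespace Summit.HubbardSuperconductivity.HubbardSuperconductivity.Theorems.KLRegimeSplit

set_option linter.dupNamespace false -- summit = problem name (single-conjunct summit), D-0017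

open Literature.MathematicalPhysics.QuantumLattice Literature.Probability.LatticeModels Literature.Analysis.FunctionSpaces
open Summit.HubbardSuperconductivity.HubbardSuperconductivity.Theorems.DispersionFlow
open Finset Complex UnitAddTorus Real
open scoped ContDiff Nat

variable {L : ℕ} [NeZero L]

/-- **The `hB` shape with the proved table**: `∀ i ≤ n, ∀ t, ‖iteratedDeriv i χ₂ t‖ ≤ klChi2CauchyTab n`. [cite: BenfattoGiulianiMastropietro2006, §2.2 (2.9)] -/
theorem salmhoferCutoff_flat_cauchy_table_deriv (n : ℕ) :
    ∀ i ≤ n, ∀ t : ℝ, ‖iteratedDeriv i salmhoferCutoff t‖ ≤ klChi2CauchyTab n := by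
  intro i hi t
  rw [← norm_iteratedFDeriv_eq_norm_iteratedDeriv]
  exact salmhoferCutoff_flat_cauchy_table n i hi t

/-- **Momentum jets of the scale-0 spatial symbol at the bare frame, table-free**:
`‖Dⁿ g_ω(y)‖ ≤ n!·(c·klChi2CauchyTab n·(n+1)!·(2/m(ω))·max(1,2/m(ω))ⁿ)·(2π·4)ⁿ`. [cite: BenfattoGiulianiMastropietro2006, §3 (3.2)] -/
theorem norm_iteratedFDeriv_uvSpatialSymbol_bare_le_tab {c Λ : ℝ} (hc : 0 ≤ c) (hΛ : 0 < Λ) (μ : ℝ) (om : ℝ) (n : ℕ) (y : Momentum) :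
    ‖iteratedFDeriv ℝ n (fun y : Momentum => uvSymbolFn c Λ (frameLevel μ 0 ((2 * π) • y)) om) y‖ ≤
      n ! * (c * klChi2CauchyTab n * (n + 1) ! * (2 / max |om| (Λ / 2)) * (max 1 (2 / max |om| (Λ / 2))) ^ n) * ((2 * π) * 4) ^ n :=
  norm_iteratedFDeriv_uvSpatialSymbol_bare_le hc hΛ μ om (one_le_klChi2CauchyTab n) (salmhoferCutoff_flat_cauchy_table_deriv n) y

/-- **Torus comparison at the bare frame, table-free** (`0 ≤ c`, `0 < Λ`, `ω ≠ 0`, `n ≥ 4`, every box radius `R`, every `L ≥ R + 1 + Σ|z_j|`).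
[cite: BenfattoGiulianiMastropietro2006, §3 (3.2)] -/
theorem norm_torusFourierInv_uvSpatialSample_sub_kernel_le_bare_tab {c Λ : ℝ} (hc : 0 ≤ c) (hΛ : 0 < Λ) (μ : ℝ) {om : ℝ} (hom : om ≠ 0)
    {n : ℕ} (hn : 2 * 2 ≤ n) {R : ℕ} (z : Site 2) (hR : (R : ℤ) + 1 + ∑ i, |z i| ≤ L) :
    ‖torusFourierInv (fun kv : TorusSite 2 L =>
          (fun y : Momentum => uvSymbolFn c Λ (frameLevel μ 0 ((2 * π) • y)) om) (WithLp.toLp 2 fun i => ((kv i).val : ℝ) / L))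
          (Torus.proj L z) -
        mFourierCoeff (Torus.descend (fun y : Momentum => uvSymbolFn c Λ (frameLevel μ 0 ((2 * π) • y)) om)
          (uvSpatialSymbol_isLatticePeriodic c Λ μ 0 om)) (-z)‖ ≤
      (n ! * (c * klChi2CauchyTab n * (n + 1) ! * (2 / max |om| (Λ / 2)) * (max 1 (2 / max |om| (Λ / 2))) ^ n) * ((2 * π) * 4) ^ n) /
          (2 * Real.pi) ^ n * (2 / ((2 * R + 2 : ℕ) : ℝ)) ^ (n - 2 * 2) * (2 ^ 2 * ∑' k : Site 2, ∏ j, (1 + (k j : ℝ) ^ 2)⁻¹) :=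
  norm_torusFourierInv_uvSpatialSample_sub_kernel_le_bare hc hΛ μ hom hn (one_le_klChi2CauchyTab n) (salmhoferCutoff_flat_cauchy_table_deriv n) z hR

/-- **Off-site L-uniform decay at the bare frame, table-free** (centred off-site `z`, `2‖z‖ ≤ L`, `n ≥ 4`). [cite: BenfattoGiulianiMastropietro2006, §3 (3.2)] -/
theorem norm_torusFourierInv_uvSpatialSample_le_inv_pow_offSite_bare_tab {c Λ : ℝ} (hc : 0 ≤ c) (hΛ : 0 < Λ) (μ : ℝ) {om : ℝ} (hom : om ≠ 0)
    {n : ℕ} (hn : 2 * 2 ≤ n) {z : Site 2} (hz : 2 * ‖z‖ ≤ L) (hz0 : Torus.proj L z ≠ 0) :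
    ‖torusFourierInv (fun kv : TorusSite 2 L =>
          (fun y : Momentum => uvSymbolFn c Λ (frameLevel μ 0 ((2 * π) • y)) om) (WithLp.toLp 2 fun i => ((kv i).val : ℝ) / L))
          (Torus.proj L z)‖ ≤
      ((n ! * (c * klChi2CauchyTab n * (n + 1) ! * (2 / max |om| (Λ / 2)) * (max 1 (2 / max |om| (Λ / 2))) ^ n) * ((2 * π) * 4) ^ n) / Real.pi ^ n) *
        (1 + (4 : ℝ) ^ n * ∑' k : Site 2, ((1 + ‖k‖) ^ n)⁻¹) * ((1 + ‖z‖) ^ n)⁻¹ :=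
  norm_torusFourierInv_uvSpatialSample_le_inv_pow_offSite_bare hc hΛ μ hom hn (one_le_klChi2CauchyTab n) (salmhoferCutoff_flat_cauchy_table_deriv n) hz hz0

/-! ## Version 2 — with the sharpened proved table `klChi2CauchyTab2` (`…SalmhoferCutoffDerivTableRecordV2`) -/

/-- **Momentum jets of the scale-0 spatial symbol at the bare frame, table-free, version 2** (`B := klChi2CauchyTab2 n`; e.g. `n = 4`: `65550`,
`n = 8`: `3.021·10¹²`). [cite: BenfattoGiulianiMastropietro2006, §3 (3.2)] -/
theorem norm_iteratedFDeriv_uvSpatialSymbol_bare_le_tab2 {c Λ : ℝ} (hc : 0 ≤ c) (hΛ : 0 < Λ) (μ : ℝ) (om : ℝ) (n : ℕ) (y : Momentum) :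
    ‖iteratedFDeriv ℝ n (fun y : Momentum => uvSymbolFn c Λ (frameLevel μ 0 ((2 * π) • y)) om) y‖ ≤
      n ! * (c * klChi2CauchyTab2 n * (n + 1) ! * (2 / max |om| (Λ / 2)) * (max 1 (2 / max |om| (Λ / 2))) ^ n) * ((2 * π) * 4) ^ n :=
  norm_iteratedFDeriv_uvSpatialSymbol_bare_le hc hΛ μ om (one_le_klChi2CauchyTab2 n) (salmhoferCutoff_flat_cauchy_table2_deriv n) y

/-- **Torus comparison at the bare frame, table-free, version 2.** [cite: BenfattoGiulianiMastropietro2006, §3 (3.2)] -/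
theorem norm_torusFourierInv_uvSpatialSample_sub_kernel_le_bare_tab2 {c Λ : ℝ} (hc : 0 ≤ c) (hΛ : 0 < Λ) (μ : ℝ) {om : ℝ} (hom : om ≠ 0)
    {n : ℕ} (hn : 2 * 2 ≤ n) {R : ℕ} (z : Site 2) (hR : (R : ℤ) + 1 + ∑ i, |z i| ≤ L) :
    ‖torusFourierInv (fun kv : TorusSite 2 L =>
          (fun y : Momentum => uvSymbolFn c Λ (frameLevel μ 0 ((2 * π) • y)) om) (WithLp.toLp 2 fun i => ((kv i).val : ℝ) / L))
          (Torus.proj L z) -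
        mFourierCoeff (Torus.descend (fun y : Momentum => uvSymbolFn c Λ (frameLevel μ 0 ((2 * π) • y)) om)
          (uvSpatialSymbol_isLatticePeriodic c Λ μ 0 om)) (-z)‖ ≤
      (n ! * (c * klChi2CauchyTab2 n * (n + 1) ! * (2 / max |om| (Λ / 2)) * (max 1 (2 / max |om| (Λ / 2))) ^ n) * ((2 * π) * 4) ^ n) /
          (2 * Real.pi) ^ n * (2 / ((2 * R + 2 : ℕ) : ℝ)) ^ (n - 2 * 2) * (2 ^ 2 * ∑' k : Site 2, ∏ j, (1 + (k j : ℝ) ^ 2)⁻¹) :=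
  norm_torusFourierInv_uvSpatialSample_sub_kernel_le_bare hc hΛ μ hom hn (one_le_klChi2CauchyTab2 n) (salmhoferCutoff_flat_cauchy_table2_deriv n) z hR

/-- **Off-site L-uniform decay at the bare frame, table-free, version 2.** [cite: BenfattoGiulianiMastropietro2006, §3 (3.2)] -/
theorem norm_torusFourierInv_uvSpatialSample_le_inv_pow_offSite_bare_tab2 {c Λ : ℝ} (hc : 0 ≤ c) (hΛ : 0 < Λ) (μ : ℝ) {om : ℝ} (hom : om ≠ 0)
    {n : ℕ} (hn : 2 * 2 ≤ n) {z : Site 2} (hz : 2 * ‖z‖ ≤ L) (hz0 : Torus.proj L z ≠ 0) :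
    ‖torusFourierInv (fun kv : TorusSite 2 L =>
          (fun y : Momentum => uvSymbolFn c Λ (frameLevel μ 0 ((2 * π) • y)) om) (WithLp.toLp 2 fun i => ((kv i).val : ℝ) / L))
          (Torus.proj L z)‖ ≤
      ((n ! * (c * klChi2CauchyTab2 n * (n + 1) ! * (2 / max |om| (Λ / 2)) * (max 1 (2 / max |om| (Λ / 2))) ^ n) * ((2 * π) * 4) ^ n) / Real.pi ^ n) *
        (1 + (4 : ℝ) ^ n * ∑' k : Site 2, ((1 + ‖k‖) ^ n)⁻¹) * ((1 + ‖z‖) ^ n)⁻¹ :=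
  norm_torusFourierInv_uvSpatialSample_le_inv_pow_offSite_bare hc hΛ μ hom hn (one_le_klChi2CauchyTab2 n) (salmhoferCutoff_flat_cauchy_table2_deriv n) hz hz0

end Summit.HubbardSuperconductivity.HubbardSuperconductivity.Theorems.KLRegimeSplit

end
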